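import Summits.QuantumFields.YangMills.Theorems.LuscherReductionTwistedTraceScalingBOStiffColour
import Summits.QuantumFields.YangMills.Theorems.LuscherReductionTwistedTraceScalingBOStiffDoor
import HarnessLib

/-!
# (B-ST) step (B), the gauge-far tail door: the refined Faddeev–Popov Cauchy–Schwarz for the BASED average — `‖P₀(𝟙_A f)‖² ≤ κ_A·∫ f²·(N₀/χ)`
# (lane A of S-BASE, crux `TwistedTraceScaling` stmt-QuantumFields-20203, C4-CORE, the (B-ST) pen; design card `pub/ym-fleet/ym-luscher-20007-p1/Lines-BST-poincare.md` (B); HANDOFF-g21 (S6))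

After step (A) (`…BOStiffColour.tubeForm_le_qform_basedIntegral`) the tube form is bounded by the transfer form of the based average `P₀v`.  The GAUGE-FAR part `v·𝟙_A` of a test function
(`A` = the region where the gauge coordinate of the record weight is large) has a based average that is small in `L²` compared with `‖v‖_w`, because along each based orbit the weight `χ`
leaves only the fraction `κ_A = sup P₀(𝟙_Aχ)/P₀χ` of its mass in `A`:
* §1 ★ `sq_basedAvg_indicator_le` — pointwise `(P₀(𝟙_A f))(U)² ≤ P₀(f²/χ)(U) · P₀(𝟙_Aχ)(U)` (Faddeev–Popov Cauchy–Schwarz, `…TubeFloorGlue.sq_integral_mul_le` on the based group);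
* §2 ★ `integral_basedAvg_mul_invariant` — `∫ (P₀q)·F = ∫ q·F` for based-invariant `F`; `basedAvg_eq_gaugeAvg_of_colourInvariant` — `P₀χ = gaugeAvg χ` for colour-invariant `χ`;
* §3 ★★ `l2_basedAvg_indicator_le` — `∫ (P₀(𝟙_A f))² ≤ κ·∫ f²·(P₀χ/χ)` whenever `P₀(𝟙_Aχ) ≤ κ·P₀χ` pointwise; with colour-invariant `χ` the weight is `softWeight χ`;
* §4 ★ `qform_le_sup_mul_l2` — the crude kernel bound `⟨f,K_βf⟩ ≤ (sup K_β)·‖f‖²` (probability space), so that `⟨P₀(𝟙_A v), K_β P₀(𝟙_A v)⟩ ≤ (sup K_β)·κ·‖v‖²_w` — to be beaten by the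
  ABSOLUTE currency floor of the record (`…BOCurrencyFloor`), `κ = e^{−ℓ²/2}` for the gauge-far region of record (`(P)` at two widths; next file).
HONEST FRAMING: bookkeeping for a stub of a child of the CONDITIONAL route R2b1; (B-ST) OPEN; C4-CORE OPEN; not infinite volume, not a gap, not Clay.
-/

set_option autoImplicit false

noncomputable section

open MeasureTheory Filter Topology Real
open scoped BigOperators
open Literature.MathematicalPhysics.QuantumFieldTheory
open Literature.MathematicalPhysics.QuantumLattice

namespace Summit.QuantumFields.YangMills.Theorems.FemtoTransferGap.TwoLattice.ConstTube

open Summit.QuantumFields.YangMills.Theorems.FemtoTransferGap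
open Summit.QuantumFields.YangMills.Theorems.FemtoTransferGap.TwoLattice.Avg

variable {L : ℕ} [NeZero L]

/-! ## §1 The pointwise Faddeev–Popov Cauchy–Schwarz on the based group, with an indicator -/

omit [NeZero L] in
/-- `h ↦ φ(U^{basedExt h})` is measurable. [folklore] -/
theorem measurable_comp_basedExt_left {φ : GaugeConfig 3 L SU2 → ℝ} (hφ : Measurable φ) (U : GaugeConfig 3 L SU2) :
    Measurable fun h : NzSite L → SU2 => φ (gaugeTransform (basedExt L h) U) :=
  (measurable_comp_gaugeTransform_left hφ U).comp (measurable_basedExt L)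

/-- ★ **`(P₀(𝟙_A f))(U)² ≤ P₀(f²/χ)(U)·P₀(𝟙_Aχ)(U)`** for bounded measurable `f` vanishing off `supp χ`, a bounded measurable weight `χ ≥ 0` with `χ ≥ c > 0` on its support, and a
measurable set `A`. [cite: SeilerLNP1982, §2] -/
theorem sq_basedAvg_indicator_le {f χ : GaugeConfig 3 L SU2 → ℝ} (hf : Measurable f) {Cf : ℝ} (hCf : ∀ U, |f U| ≤ Cf) (hχ : Measurable χ) {Cχ : ℝ} (hCχ : ∀ U, |χ U| ≤ Cχ)
    (hχ0 : ∀ U, 0 ≤ χ U) {c : ℝ} (hc : 0 < c) (hcχ : ∀ U, χ U ≠ 0 → c ≤ χ U) (hsupp : ∀ U, χ U = 0 → f U = 0) {A : Set (GaugeConfig 3 L SU2)} (hA : MeasurableSet A)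
    (U : GaugeConfig 3 L SU2) :
    (∫ h, A.indicator f (gaugeTransform (basedExt L h) U) ∂basedMeasure L) ^ 2 ≤
      (∫ h, f (gaugeTransform (basedExt L h) U) ^ 2 / χ (gaugeTransform (basedExt L h) U) ∂basedMeasure L) *
        ∫ h, A.indicator χ (gaugeTransform (basedExt L h) U) ∂basedMeasure L := by
  haveI : IsProbabilityMeasure (basedMeasure L) := by unfold basedMeasure; infer_instance
  have hCf0 : 0 ≤ Cf := (abs_nonneg _).trans (hCf U)
  have hCχ0 : 0 ≤ Cχ := (abs_nonneg _).trans (hCχ U)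
  -- `F := f/χ`, `wA := 𝟙_A χ`
  have hFb : ∀ V, |f V / χ V| ≤ Cf / c := fun V => by
    by_cases h : χ V = 0
    · rw [h, div_zero, abs_zero]; positivity
    · rw [abs_div, abs_of_pos (hc.trans_le (hcχ V h))]; exact div_le_div₀ hCf0 (hCf V) hc (hcχ V h)
  have hid1 : ∀ V, A.indicator f V = f V / χ V * A.indicator χ V := fun V => by
    by_cases hV : V ∈ A
    · rw [Set.indicator_of_mem hV, Set.indicator_of_mem hV]
      by_cases h : χ V = 0
      · rw [h, mul_zero, hsupp V h]
      · rw [div_mul_cancel₀ _ h]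
    · rw [Set.indicator_of_notMem hV, Set.indicator_of_notMem hV, mul_zero]
  have hid2 : ∀ V, (f V / χ V) ^ 2 * A.indicator χ V ≤ f V ^ 2 / χ V := fun V => by
    by_cases hV : V ∈ A
    · rw [Set.indicator_of_mem hV]
      by_cases h : χ V = 0
      · rw [h, mul_zero, div_zero]
      · rw [show (f V / χ V) ^ 2 * χ V = f V ^ 2 / χ V by field_simp]
    · rw [Set.indicator_of_notMem hV, mul_zero]; exact div_nonneg (sq_nonneg _) (hχ0 V)
  have hwA : Measurable (A.indicator χ) := hχ.indicator hA
  have hwAb : ∀ V, |A.indicator χ V| ≤ Cχ := fun V => by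
    by_cases hV : V ∈ A
    · rw [Set.indicator_of_mem hV]; exact hCχ V
    · rw [Set.indicator_of_notMem hV, abs_zero]; exact hCχ0
  have hwA0 : ∀ V, 0 ≤ A.indicator χ V := fun V => by
    by_cases hV : V ∈ A
    · rw [Set.indicator_of_mem hV]; exact hχ0 V
    · rw [Set.indicator_of_notMem hV]
  have e1 : (fun h : NzSite L → SU2 => A.indicator f (gaugeTransform (basedExt L h) U)) =
      fun h => f (gaugeTransform (basedExt L h) U) / χ (gaugeTransform (basedExt L h) U) * A.indicator χ (gaugeTransform (basedExt L h) U) := funext fun h => hid1 _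
  rw [e1]
  have hcs := sq_integral_mul_le (basedMeasure L) ((measurable_comp_basedExt_left hf U).div (measurable_comp_basedExt_left hχ U)) (measurable_comp_basedExt_left hwA U)
    (fun h => hFb _) (fun h => hwAb _) (fun h => hwA0 _)
  refine hcs.trans (mul_le_mul_of_nonneg_right ?_ (integral_nonneg fun h => hwA0 _))
  refine integral_mono ?_ ?_ fun h => hid2 _
  · exact integrable_of_measurable_abs_le _ ((((measurable_comp_basedExt_left hf U).div (measurable_comp_basedExt_left hχ U)).pow_const 2).mul (measurable_comp_basedExt_left hwA U))
      (C := (Cf / c) ^ 2 * Cχ) fun h => by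
        rw [abs_mul, abs_pow]; exact mul_le_mul (pow_le_pow_left₀ (abs_nonneg _) (hFb _) 2) (hwAb _) (abs_nonneg _) (sq_nonneg _)
  · refine integrable_of_measurable_abs_le _ (((measurable_comp_basedExt_left hf U).pow_const 2).div (measurable_comp_basedExt_left hχ U)) (C := Cf ^ 2 / c) fun h => ?_
    set V := gaugeTransform (basedExt L h) U
    by_cases hV : χ V = 0
    · rw [hV, div_zero, abs_zero]; positivity
    · rw [abs_div, abs_of_pos (hc.trans_le (hcχ V hV)), abs_pow]
      exact div_le_div₀ (sq_nonneg _) (pow_le_pow_left₀ (abs_nonneg _) (hCf V) 2) hc (hcχ V hV)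

/-! ## §2 The based average is self-adjoint against based-invariant functions; colour-invariant weights -/

/-- ★ `∫ (P₀q)(U) F(U) dU = ∫ q(U) F(U) dU` for bounded measurable `q` and bounded measurable BASED-invariant `F`. [cite: SeilerLNP1982, §2] -/
theorem integral_basedAvg_mul_invariant {q F : GaugeConfig 3 L SU2 → ℝ} (hq : Measurable q) {Cq : ℝ} (hCq : ∀ U, |q U| ≤ Cq) (hF : Measurable F) {CF : ℝ}
    (hCF : ∀ U, |F U| ≤ CF) (hFinv : ∀ (h : NzSite L → SU2) (U : GaugeConfig 3 L SU2), F (gaugeTransform (basedExt L h) U) = F U) :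
    ∫ U, (∫ h, q (gaugeTransform (basedExt L h) U) ∂basedMeasure L) * F U ∂configMeasure SU2 L = ∫ U, q U * F U ∂configMeasure SU2 L := by
  haveI : IsProbabilityMeasure (basedMeasure L) := by unfold basedMeasure; infer_instance
  have hJ : Measurable fun p : GaugeConfig 3 L SU2 × (NzSite L → SU2) => q (gaugeTransform (basedExt L p.2) p.1) * F (gaugeTransform (basedExt L p.2) p.1) :=
    (measurable_comp_basedAction hq).mul (measurable_comp_basedAction hF)
  have hJb : ∀ p : GaugeConfig 3 L SU2 × (NzSite L → SU2), |q (gaugeTransform (basedExt L p.2) p.1) * F (gaugeTransform (basedExt L p.2) p.1)| ≤ Cq * CF := fun p => by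
    rw [abs_mul]; exact mul_le_mul (hCq _) (hCF _) (abs_nonneg _) ((abs_nonneg _).trans (hCq p.1))
  have hint : Integrable (fun p : GaugeConfig 3 L SU2 × (NzSite L → SU2) => q (gaugeTransform (basedExt L p.2) p.1) * F (gaugeTransform (basedExt L p.2) p.1))
      ((configMeasure SU2 L).prod (basedMeasure L)) := integrable_of_measurable_abs_le _ hJ hJb
  calc ∫ U, (∫ h, q (gaugeTransform (basedExt L h) U) ∂basedMeasure L) * F U ∂configMeasure SU2 L
      = ∫ U, ∫ h, q (gaugeTransform (basedExt L h) U) * F (gaugeTransform (basedExt L h) U) ∂basedMeasure L ∂configMeasure SU2 L := by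
        refine integral_congr_ae (ae_of_all _ fun U => ?_)
        dsimp only
        rw [← integral_mul_const]
        exact integral_congr_ae (ae_of_all _ fun h => by dsimp only; rw [hFinv])
    _ = ∫ h, ∫ U, q (gaugeTransform (basedExt L h) U) * F (gaugeTransform (basedExt L h) U) ∂configMeasure SU2 L ∂basedMeasure L := integral_integral_swap hint
    _ = ∫ h, ∫ U, q U * F U ∂configMeasure SU2 L ∂basedMeasure L := by
        refine integral_congr_ae (ae_of_all _ fun h => ?_)
        dsimp only
        exact integral_comp_eq_of_measurePreserving (measurePreserving_gaugeTransform_configMeasure (basedExt L h)) (F := fun W => q W * F W) (hq.mul hF)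
    _ = ∫ U, q U * F U ∂configMeasure SU2 L := by simp [integral_const]

/-- The based average of a bounded measurable function is based invariant. [folklore] -/
theorem basedAvg_invariant (q : GaugeConfig 3 L SU2 → ℝ) (h₀ : NzSite L → SU2) (U : GaugeConfig 3 L SU2) :
    (∫ h, q (gaugeTransform (basedExt L h) (gaugeTransform (basedExt L h₀) U)) ∂basedMeasure L) = ∫ h, q (gaugeTransform (basedExt L h) U) ∂basedMeasure L := by
  have e : ∀ h, gaugeTransform (basedExt L h) (gaugeTransform (basedExt L h₀) U) = gaugeTransform (basedExt L (h * h₀)) U := fun h => by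
    rw [gaugeTransform_gaugeTransform]
    congr 1
    funext x; by_cases hx : x = 0
    · subst hx; simp [basedExt]
    · simp [basedExt, hx]
  simp_rw [e]
  exact integral_mul_right_eq_self (fun h => q (gaugeTransform (basedExt L h) U)) h₀

/-- For a COLOUR-invariant `χ` the based average is the full gauge average: `P₀χ = gaugeAvg χ`. [folklore] -/
theorem basedAvg_eq_gaugeAvg_of_colourInvariant {χ : GaugeConfig 3 L SU2 → ℝ} (hχ : Measurable χ) {Cχ : ℝ} (hCχ : ∀ U, |χ U| ≤ Cχ)
    (hcol : ∀ (c : SU2) (U : GaugeConfig 3 L SU2), χ (gaugeTransform (fun _ : Site 3 L => c) U) = χ U) (U : GaugeConfig 3 L SU2) :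
    (∫ h, χ (gaugeTransform (basedExt L h) U) ∂basedMeasure L) = gaugeAvg χ U := by
  haveI : IsProbabilityMeasure (haarProbability SU2) := by infer_instance
  unfold gaugeAvg
  rw [integral_gaugeMeasure_eq_colour_based L (measurable_comp_gaugeTransform_left hχ U) (C := Cχ) fun g => hCχ _]
  have e : ∀ (c : SU2) (h : NzSite L → SU2), χ (gaugeTransform (fun x => c * basedExt L h x) U) = χ (gaugeTransform (basedExt L h) U) := fun c h => by
    have e1 : (fun x => c * basedExt L h x) = (fun _ : Site 3 L => c) * basedExt L h := rfl
    rw [e1, ← gaugeTransform_gaugeTransform, hcol]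
  simp_rw [e]
  simp [integral_const]

/-! ## §3 ★★ The `L²` bound for the based average of a gauge-far piece -/

/-- ★★ **`∫ (P₀(𝟙_A f))² ≤ κ·∫ f²·(P₀χ/χ)`** whenever `P₀(𝟙_Aχ) ≤ κ·P₀χ` pointwise, for `f`, `χ` as in `sq_basedAvg_indicator_le`. [cite: SeilerLNP1982, §2] -/
theorem l2_basedAvg_indicator_le {f χ : GaugeConfig 3 L SU2 → ℝ} (hf : Measurable f) {Cf : ℝ} (hCf : ∀ U, |f U| ≤ Cf) (hχ : Measurable χ) {Cχ : ℝ} (hCχ : ∀ U, |χ U| ≤ Cχ)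
    (hχ0 : ∀ U, 0 ≤ χ U) {c : ℝ} (hc : 0 < c) (hcχ : ∀ U, χ U ≠ 0 → c ≤ χ U) (hsupp : ∀ U, χ U = 0 → f U = 0) {A : Set (GaugeConfig 3 L SU2)} (hA : MeasurableSet A)
    {κ : ℝ} (hκA : ∀ U, ∫ h, A.indicator χ (gaugeTransform (basedExt L h) U) ∂basedMeasure L ≤ κ * ∫ h, χ (gaugeTransform (basedExt L h) U) ∂basedMeasure L) :
    ∫ U, (∫ h, A.indicator f (gaugeTransform (basedExt L h) U) ∂basedMeasure L) ^ 2 ∂configMeasure SU2 L ≤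
      κ * ∫ U, f U ^ 2 * ((∫ h, χ (gaugeTransform (basedExt L h) U) ∂basedMeasure L) / χ U) ∂configMeasure SU2 L := by
  have hCf0 : 0 ≤ Cf := (abs_nonneg _).trans (hCf 1)
  -- the based average `N = P₀χ`: measurable, bounded, based invariant
  obtain ⟨hNm, hNb⟩ := basedIntegral_props (L := L) hχ hCχ
  have hNinv : ∀ (h : NzSite L → SU2) (U : GaugeConfig 3 L SU2),
      (∫ h', χ (gaugeTransform (basedExt L h') (gaugeTransform (basedExt L h) U)) ∂basedMeasure L) = ∫ h', χ (gaugeTransform (basedExt L h') U) ∂basedMeasure L :=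
    fun h U => basedAvg_invariant χ h U
  have hN0 : ∀ U, 0 ≤ ∫ h, χ (gaugeTransform (basedExt L h) U) ∂basedMeasure L := fun U => integral_nonneg fun h => hχ0 _
  -- the based average of `𝟙_A f` and of `f²/χ`
  have hfA : Measurable (A.indicator f) := hf.indicator hA
  have hfAb : ∀ U, |A.indicator f U| ≤ Cf := fun U => by
    by_cases hU : U ∈ A
    · rw [Set.indicator_of_mem hU]; exact hCf U
    · rw [Set.indicator_of_notMem hU, abs_zero]; exact hCf0
  obtain ⟨hPm, hPb⟩ := basedIntegral_props (L := L) hfA hfAb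
  have hqm : Measurable fun V => f V ^ 2 / χ V := (hf.pow_const 2).div hχ
  have hqb : ∀ V, |f V ^ 2 / χ V| ≤ Cf ^ 2 / c := fun V => by
    by_cases h : χ V = 0
    · rw [h, div_zero, abs_zero]; positivity
    · rw [abs_div, abs_of_pos (hc.trans_le (hcχ V h)), abs_pow]
      exact div_le_div₀ (sq_nonneg _) (pow_le_pow_left₀ (abs_nonneg _) (hCf V) 2) hc (hcχ V h)
  obtain ⟨hQm, hQb⟩ := basedIntegral_props (L := L) hqm hqb
  have hQ0 : ∀ U, 0 ≤ ∫ h, f (gaugeTransform (basedExt L h) U) ^ 2 / χ (gaugeTransform (basedExt L h) U) ∂basedMeasure L :=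
    fun U => integral_nonneg fun h => div_nonneg (sq_nonneg _) (hχ0 _)
  -- pointwise, then integrate
  have hpt : ∀ U, (∫ h, A.indicator f (gaugeTransform (basedExt L h) U) ∂basedMeasure L) ^ 2 ≤
      κ * ((∫ h, f (gaugeTransform (basedExt L h) U) ^ 2 / χ (gaugeTransform (basedExt L h) U) ∂basedMeasure L) * ∫ h, χ (gaugeTransform (basedExt L h) U) ∂basedMeasure L) := fun U => by
    have h1 := sq_basedAvg_indicator_le hf hCf hχ hCχ hχ0 hc hcχ hsupp hA U
    have h2 := mul_le_mul_of_nonneg_left (hκA U) (hQ0 U)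
    nlinarith [h1, h2]
  calc ∫ U, (∫ h, A.indicator f (gaugeTransform (basedExt L h) U) ∂basedMeasure L) ^ 2 ∂configMeasure SU2 L
      ≤ ∫ U, κ * ((∫ h, f (gaugeTransform (basedExt L h) U) ^ 2 / χ (gaugeTransform (basedExt L h) U) ∂basedMeasure L) * ∫ h, χ (gaugeTransform (basedExt L h) U) ∂basedMeasure L)
          ∂configMeasure SU2 L := by
        refine integral_mono (integrable_of_measurable_abs_le _ (hPm.pow_const 2) (C := Cf ^ 2) fun U => by rw [abs_pow]; exact pow_le_pow_left₀ (abs_nonneg _) (hPb U) 2)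
          ((integrable_of_measurable_abs_le _ (f := fun U => (∫ h, f (gaugeTransform (basedExt L h) U) ^ 2 / χ (gaugeTransform (basedExt L h) U) ∂basedMeasure L) *
              ∫ h, χ (gaugeTransform (basedExt L h) U) ∂basedMeasure L) (hQm.mul hNm) (C := (Cf ^ 2 / c) * Cχ) fun U => by
            rw [abs_mul]; exact mul_le_mul (hQb U) (hNb U) (abs_nonneg _) (by positivity)).const_mul κ) hpt
    _ = κ * ∫ U, (f U ^ 2 / χ U) * ∫ h, χ (gaugeTransform (basedExt L h) U) ∂basedMeasure L ∂configMeasure SU2 L := by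
        rw [integral_const_mul, integral_basedAvg_mul_invariant hqm hqb hNm hNb hNinv]
    _ = κ * ∫ U, f U ^ 2 * ((∫ h, χ (gaugeTransform (basedExt L h) U) ∂basedMeasure L) / χ U) ∂configMeasure SU2 L := by
        congr 1
        exact integral_congr_ae (ae_of_all _ fun U => by ring)

/-! ## §4 The crude kernel bound -/

/-- ★ **`⟨f, K_β f⟩ ≤ (sup K_β)·‖f‖²`** for bounded measurable `f` (probability space: `(∫|f|)² ≤ ∫f²`). [folklore] -/
theorem qform_le_sup_mul_l2 (β : ℝ) {Msup : ℝ} (hM : ∀ U V : GaugeConfig 3 L SU2, transferKernel su2Rep β U V ≤ Msup) {f : GaugeConfig 3 L SU2 → ℝ} (hf : Measurable f)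
    {Cf : ℝ} (hCf : ∀ U, |f U| ≤ Cf) : qform su2Rep β f f ≤ Msup * l2 f f := by
  have hM0 : 0 ≤ Msup := (transferKernel_pos su2Rep β (1 : GaugeConfig 3 L SU2) 1).le.trans (hM 1 1)
  have hCf0 : 0 ≤ Cf := (abs_nonneg _).trans (hCf 1)
  have hfa : Measurable fun U => |f U| := hf.abs
  have hfab : ∀ U, |(|f U|)| ≤ Cf := fun U => by rw [abs_abs]; exact hCf U
  -- `∫∫ fKf ≤ ∫∫ |f| M |f| = M (∫|f|)² ≤ M ∫ f²`
  have h1 : qform su2Rep β f f ≤ ∫ U, ∫ V, |f U| * Msup * |f V| ∂configMeasure SU2 L ∂configMeasure SU2 L := by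
    rw [qform_eq_integral_prod_bdd β hf hCf hf hCf]
    have hm : Measurable (Function.uncurry fun U V : GaugeConfig 3 L SU2 => |f U| * Msup * |f V|) := ((hfa.comp measurable_fst).mul measurable_const).mul (hfa.comp measurable_snd)
    have hb : ∀ U V : GaugeConfig 3 L SU2, |(|f U|) * Msup * (|f V|)| ≤ Cf * Msup * Cf := fun U V => by
      rw [abs_mul, abs_mul, abs_abs, abs_abs, abs_of_nonneg hM0]
      exact mul_le_mul (mul_le_mul_of_nonneg_right (hCf U) hM0) (hCf V) (abs_nonneg _) (mul_nonneg hCf0 hM0)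
    rw [StiffDoor.integral_integral_eq_prod (μ := configMeasure SU2 L) hm hb]
    refine integral_mono (integrable_qform_integrand β hf hCf hf hCf) (StiffDoor.integrable_prod_of_bdd (μ := configMeasure SU2 L) hm hb) fun p => ?_
    dsimp only [Function.uncurry]
    have hK := transferKernel_pos su2Rep β p.1 p.2
    calc f p.1 * transferKernel su2Rep β p.1 p.2 * f p.2 ≤ |f p.1 * transferKernel su2Rep β p.1 p.2 * f p.2| := le_abs_self _
      _ = |f p.1| * transferKernel su2Rep β p.1 p.2 * |f p.2| := by rw [abs_mul, abs_mul, abs_of_pos hK]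
      _ ≤ |f p.1| * Msup * |f p.2| := mul_le_mul_of_nonneg_right (mul_le_mul_of_nonneg_left (hM _ _) (abs_nonneg _)) (abs_nonneg _)
  have h2 : ∫ U, ∫ V, |f U| * Msup * |f V| ∂configMeasure SU2 L ∂configMeasure SU2 L = Msup * (∫ U, |f U| ∂configMeasure SU2 L) ^ 2 := by
    have e : ∀ U, ∫ V, |f U| * Msup * |f V| ∂configMeasure SU2 L = (Msup * |f U|) * ∫ V, |f V| ∂configMeasure SU2 L := fun U => by
      rw [← integral_const_mul]; exact integral_congr_ae (ae_of_all _ fun V => by ring)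
    simp_rw [e]
    rw [integral_mul_const, integral_const_mul]
    ring
  have h3 : (∫ U, |f U| ∂configMeasure SU2 L) ^ 2 ≤ l2 f f := by
    have h := sq_integral_mul_le (configMeasure SU2 L) hfa measurable_const (Cw := 1) hfab (fun _ => by norm_num) (fun _ => zero_le_one)
    simp only [mul_one, integral_const, probReal_univ, smul_eq_mul, sq_abs] at h
    unfold l2
    refine h.trans (le_of_eq (integral_congr_ae (ae_of_all _ fun U => by ring)))
  calc qform su2Rep β f f ≤ _ := h1
    _ = Msup * (∫ U, |f U| ∂configMeasure SU2 L) ^ 2 := h2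
    _ ≤ Msup * l2 f f := mul_le_mul_of_nonneg_left h3 hM0

end Summit.QuantumFields.YangMills.Theorems.FemtoTransferGap.TwoLattice.ConstTube

end
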